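import Literature.MathematicalPhysics.QuantumLattice.TypeClassSidecarReaderUCell
import HarnessLib

/-!
# Thermal DOCC CAPS from a corner Markov (C1) certificate at `U₁` and a «c2-sector» sidecar at `U₂ > U₁`, SAME `β`:
# the `U`-chord of the canonical pressure read with the producers' certificates

Family `hubbard` (topic `MathematicalPhysics/QuantumLattice`), seat hubbard-downfold-unc-1 (the `U` direction of «a parameter BOX maps
to a certified word»). `HubbardTTPrimePressureFloorUTransport` §7 (this seat) turned two all-tori pressure inputs at ONE temperature and
TWO couplings `U₁ < U₂` — a CEILING `u` at `U₁`, a FLOOR `W` at `U₂` — into the thermal docc ceiling word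
`D(ω) = Re ω(n↑n↓) ≤ (u − W)/(β (U₂ − U₁))` for every torus limit of the canonical sector Gibbs states at `(β, t, t', U, n)`, every
`U ≥ U₂` (the pressure is convex and decreasing in `U` with slope `−β D`). Until now the only certified ceiling at the sidecar's `β` was the
energy-floor pressure ceiling at `U₁ = 0` (`TypeClassSidecarReaderUBox` §4: `u = s − β e_FS`, a `U`-distance of `U₂`). hubbard-thermal-eng-2's
rectangle / staircase Markov certificates at `U₁ = 8` sit at temperatures `β ∈ {1/8, …, 1}` that the sidecars share, and hubbard-thermal-p2's
sidecars at the box end `U₂ = 9` are one coupling unit away — so the same chord now reads with a CERTIFIED ceiling one unit to the left: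

* `IsTorusLimitOfMixture.meanEnergy_onSite_le_of_c2Check_right_of_cornerMarkovCertificate_left_U_allTori` (`t' = 0`, generic corner
  window): C1 at `(β, μ, U₁)` with constant `c`, checked sidecar at `(β, U₂)`, `U₁ < U₂ ≤ U` ⇒
  `D(ω) ≤ ((c − β μ n) − Wnum/Wden)/(β (U₂ − U₁))`;
* the rectangle corollary `…_of_c2Check_right_of_rectMarkovCertificate_left_U_allTori`.

Everything is PROVED; no definition, no named fact, no number. HONEST SCOPE: a docc CEILING word on the half-line `U ≥ U₂` only (the floor word
on `U ≤ U₁` would need a pressure ceiling to the RIGHT of the sidecar); `t' = 0` (at `t' ≠ 0` the transported ceiling carries `β |t'| 16/π²`, which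
at the shared temperatures exceeds the kinematic docc bound — not stated). WHAT THIS IS NOT: no certificate, no phase sentence.

## Mathlib / tree search

REUSED: `IsTorusLimitOfMixture.meanEnergy_onSite_le_of_pressure_bounds_U_allTori` (`HubbardTTPrimePressureFloorUTransport` §7);
`eventually_pressureFloor_of_c2Check_of_le_U` (`TypeClassSidecarReaderUBox` §2); `c2Check_sound`, `density_nonneg_of_type`;
`eventually_log_partitionFn_sectorHamiltonianTT'_le_of_clusterCertificate` + corner bookkeeping (`bondWeightSum_cornerBondWeight`,
`siteWeightSum_cornerSiteWeight`, `siteWeightSum_mul_cornerSiteWeight`, `hubbardTorusTT'_zero_sub_mu`, `relabel_translate_hubbardTorusWith`,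
`relabel_translate_gibbsDensity`, `isHermitian_windowAnnihilator`, `trace_window_mul_windowAnnihilator`); rectangle bookkeeping
(`rectCorner_mem_rectWindow`, `toLex_le_toLex_rectCorner`, `rectCorner_sub_unitVec_mem_rectWindow`, `rectWindow_subset_halfOpenBox_max`).
`rg 'onSite_le_of_c2Check_right_of_(corner|rect)Markov' Literature/MathematicalPhysics/QuantumLattice` (2026-08-27): nothing.

## References

* E. H. Lieb, Commun. Math. Phys. 31 (1973) 327, §V (5.2)–(5.4) (Peierls–Bogoliubov; the coupling-constant chord). [cite: Lieb1973, §V (5.2)–(5.4)]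
* T. Koma, H. Tasaki, J. Stat. Phys. 76 (1994) 745, §1 (convexity of the free energy in a coupling). [cite: KomaTasaki1994, §1]
* D. Poulin, M. B. Hastings, Phys. Rev. Lett. 106 (2011) 080403, eqs. (3)–(8). [cite: PoulinHastings2011, eqs. (3)–(8)]
* R. B. Israel, *Convexity in the Theory of Lattice Gases* (1979), Thm. I.3.4. [cite: Israel1979, Thm. I.3.4]
-/

noncomputable section

namespace Literature.MathematicalPhysics.QuantumLattice

open Matrix Finset HubbardWave0 ThermodynamicLimit LiebThm1 AndersonCluster Literature.Probability.LatticeModels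
open _root_.Filter
open scoped _root_.Topology ComplexOrder BigOperators

namespace InfVolFermionState

variable {t U n β : ℝ} {ω : InfVolFermionState 2} {Ls : ℕ → ℕ}

/-- **Thermal DOCC CAP on the half-line `U ≥ U₂` from a corner Markov certificate at `(β, U₁)` and a checked «c2-sector»
sidecar at `(β, U₂)`, `U₁ < U₂`, SAME temperature, every torus limit** (`t' = 0`, `0 ≤ n ≤ 2` via the type, `β > 0`): for every
torus limit `ω` of the canonical sector Gibbs states at `(β, t, 0, U, n)` along any `Ls → ∞`, `U ≥ U₂`,
`Re ω(n↑n↓) ≤ ((c − β μ n) − Wnum/Wden)/(β (U₂ − U₁))`.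
[cite: Lieb1973, §V (5.2)–(5.4)] [cite: KomaTasaki1994, §1] [cite: PoulinHastings2011, eqs. (3)–(8)] -/
theorem IsTorusLimitOfMixture.meanEnergy_onSite_le_of_c2Check_right_of_cornerMarkovCertificate_left_U_allTori
    (hn2 : n ≤ 2) {U₁ U₂ : ℝ} (hU12 : U₁ < U₂) (hU : U₂ ≤ U)
    (h : ω.IsTorusLimitOfMixture (sectorGibbsCount n) (fun L => sectorGibbsWeightTT' β t 0 U n L)
      (fun L => sectorGibbsVectorTT' t 0 U n L) Ls)
    (hLs : Tendsto Ls atTop atTop) (hβ : 0 < β)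
    -- C2 at `(β, U₂)`
    {a b : ℕ} (ha : 1 ≤ a) (hb : 1 ≤ b) {rows : List C2Row} {P K q A₀ : ℕ} {Wnum : ℤ} {Wden : ℕ}
    (hcheck : c2Check P K q A₀ a b rows Wnum Wden = true) (hn : n * ((q : ℝ) * a * b) = 2 * A₀)
    (hnode : ∀ r ∈ rows,
      r.floor ≤ (partitionFn β (spinSectorHamiltonian r.nu r.nd (hubbardOpenBoxTT' a b t 0 U₂))).re)
    -- C1 (corner window) at `(β, μ, U₁)` — the SAME `β`
    (μ : ℝ) {Λ : Finset (Site 2)} {x₀ : Site 2} (hx₀ : x₀ ∈ Λ) (hmax : ∀ y ∈ Λ, toLex y ≤ toLex x₀)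
    (hcorner : ∀ i : Fin 2, x₀ - unitVec i ∈ Λ) {ℓw : ℕ} (hΛ : Λ ⊆ halfOpenBox 2 ℓw)
    {ι : Type*} (sι : Finset ι) (Sw : ι → Finset (Site 2)) (hS : ∀ i, Sw i ⊆ Λ) (zw : ι → Site 2)
    (hzw : ∀ i, shiftSet (zw i) (Sw i) ⊆ Λ) {O : ∀ i, FermionOp (Sw i)} (hO : ∀ i ∈ sι, (O i).IsHermitian)
    (g : ι → ℝ) {LB : FermionOp (Λ.erase x₀)} (hLB : LB.IsHermitian) {c : ℝ}
    (hcert : ((Real.exp c : ℂ) • cfc Real.exp LB -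
      fermionPartialTrace (PolySite.incl (Finset.erase_subset x₀ Λ))
        (cfc Real.exp (-((β : ℂ) • (cornerEnergyRep Λ x₀ t U₁ μ + windowAnnihilator sι Λ Sw hS zw hzw O g)) +
          fermionEmbed (PolySite.incl (Finset.erase_subset x₀ Λ)) LB))).PosSemidef) :
    ω.meanEnergy (hubbardTTPrimeFermionInteraction 0 0 1) 1 ≤ ((c - β * μ * n) - (Wnum : ℝ) / Wden) / (β * (U₂ - U₁)) := by
  obtain ⟨-, hq, -⟩ := c2Check_sound hcheck ha hb
  have hn0 : 0 ≤ n := density_nonneg_of_type ha hb hq hn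
  have hKTI : ∀ (L : ℕ) [NeZero L], ∀ w : TorusSite 2 L,
      relabel (Orb.translate w) (hubbardTorusTT' L t 0 U₁ - (μ : ℂ) • totalNumber) =
        hubbardTorusTT' L t 0 U₁ - (μ : ℂ) • totalNumber := fun L _ w => by
    rw [hubbardTorusTT'_zero_sub_mu, relabel_translate_hubbardTorusWith]
  exact h.meanEnergy_onSite_le_of_pressure_bounds_U_allTori hn0 hn2 hβ hU12 hU
    (fun Ls' hLs' ε hε => eventually_log_partitionFn_sectorHamiltonianTT'_le_of_clusterCertificate t U₁ μ β hn0 hn2 hLs'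
      hx₀ hmax hΛ (fun i => bondWeightSum_cornerBondWeight hx₀ (hcorner i)) (siteWeightSum_cornerSiteWeight hx₀)
      (siteWeightSum_mul_cornerSiteWeight hx₀ (-μ)) (isHermitian_windowAnnihilator sι _ Sw hS zw hzw hO g)
      (fun L _ hL3 hℓL => trace_window_mul_windowAnnihilator (relabel_translate_gibbsDensity L (hKTI L) β)
        _ sι Sw hS zw hzw O g) hLB hcert hε)
    (fun Ls' hLs' ε hε => eventually_pressureFloor_of_c2Check_of_le_U t 0 n le_rfl hβ.le ha hb hcheck hn hn2 hnode hLs' hε)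
    hLs

/-- **Rectangle corollary** (`Λ = rectWindow a' b'`, corner `(a' − 1, b' − 1)`, `a', b' ≥ 2`): rectangle C1 at `(β, μ, U₁)`, checked
sidecar at `(β, U₂)`, `U₁ < U₂ ≤ U` ⇒ `Re ω(n↑n↓) ≤ ((c − β μ n) − Wnum/Wden)/(β (U₂ − U₁))` for every torus limit at `(β, t, 0, U, n)`.
[cite: Lieb1973, §V (5.2)–(5.4)] [cite: KomaTasaki1994, §1] [cite: PoulinHastings2011, eqs. (3)–(8)] -/
theorem IsTorusLimitOfMixture.meanEnergy_onSite_le_of_c2Check_right_of_rectMarkovCertificate_left_U_allTori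
    (hn2 : n ≤ 2) {U₁ U₂ : ℝ} (hU12 : U₁ < U₂) (hU : U₂ ≤ U)
    (h : ω.IsTorusLimitOfMixture (sectorGibbsCount n) (fun L => sectorGibbsWeightTT' β t 0 U n L)
      (fun L => sectorGibbsVectorTT' t 0 U n L) Ls)
    (hLs : Tendsto Ls atTop atTop) (hβ : 0 < β)
    -- C2 at `(β, U₂)`
    {a b : ℕ} (ha : 1 ≤ a) (hb : 1 ≤ b) {rows : List C2Row} {P K q A₀ : ℕ} {Wnum : ℤ} {Wden : ℕ}
    (hcheck : c2Check P K q A₀ a b rows Wnum Wden = true) (hn : n * ((q : ℝ) * a * b) = 2 * A₀)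
    (hnode : ∀ r ∈ rows,
      r.floor ≤ (partitionFn β (spinSectorHamiltonian r.nu r.nd (hubbardOpenBoxTT' a b t 0 U₂))).re)
    -- C1 (rectangle) at `(β, μ, U₁)`
    (μ : ℝ) {a' b' : ℕ} (ha' : 2 ≤ a') (hb' : 2 ≤ b')
    {ι : Type*} (sι : Finset ι) (Sw : ι → Finset (Site 2)) (hS : ∀ i, Sw i ⊆ rectWindow a' b') (zw : ι → Site 2)
    (hzw : ∀ i, shiftSet (zw i) (Sw i) ⊆ rectWindow a' b') {O : ∀ i, FermionOp (Sw i)}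
    (hO : ∀ i ∈ sι, (O i).IsHermitian) (g : ι → ℝ)
    {LB : FermionOp ((rectWindow a' b').erase (mkSite2 (a' - 1) (b' - 1)))} (hLB : LB.IsHermitian) {c : ℝ}
    (hcert : ((Real.exp c : ℂ) • cfc Real.exp LB -
      fermionPartialTrace (PolySite.incl (Finset.erase_subset (mkSite2 (a' - 1) (b' - 1)) (rectWindow a' b')))
        (cfc Real.exp (-((β : ℂ) • (cornerEnergyRep (rectWindow a' b') (mkSite2 (a' - 1) (b' - 1)) t U₁ μ +
            windowAnnihilator sι (rectWindow a' b') Sw hS zw hzw O g)) +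
          fermionEmbed (PolySite.incl (Finset.erase_subset (mkSite2 (a' - 1) (b' - 1)) (rectWindow a' b'))) LB))).PosSemidef) :
    ω.meanEnergy (hubbardTTPrimeFermionInteraction 0 0 1) 1 ≤ ((c - β * μ * n) - (Wnum : ℝ) / Wden) / (β * (U₂ - U₁)) :=
  h.meanEnergy_onSite_le_of_c2Check_right_of_cornerMarkovCertificate_left_U_allTori hn2 hU12 hU hLs hβ ha hb hcheck hn hnode μ
    (rectCorner_mem_rectWindow (by omega) (by omega)) toLex_le_toLex_rectCorner (rectCorner_sub_unitVec_mem_rectWindow ha' hb')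
    (rectWindow_subset_halfOpenBox_max a' b') sι Sw hS zw hzw hO g hLB hcert

end InfVolFermionState

end Literature.MathematicalPhysics.QuantumLattice

end
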